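import Summits.Ventures.Crystal3D.Theorems.StickyWulffConstantGenericWallFloorShellRowCertBridgeA
import HarnessLib

/-!
# Lane G's two-centre SHELL ROW, part 3: the BRIDGE `shellRowHolds_of_coverCheck` (crux `GenericWallFloor`, line `WallLedgerG`)

HONEST FRAMING. Venture `Summits/Ventures/Crystal3D` (cell `crystal3d-full`), helper `--supports` the crux
`GenericWallFloor` (stmt-Ventures-19480) of `route-Ventures-StickyWulffConstant`, REGISTERED line `WallLedgerG`, open
stub `stub_twoSlabAdhesion`.  Rung credit only; F-C1 not moved; NOT the stub.  AUTHORSHIP: written by the cell's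
certified-computation planner cf-p2 g18 (PREREG §43, HOME/cf-p2/gtwo/bridge/ShellRowCertFull.lean, kit j314276, 0 sorries)
and landed verbatim (split into tree-sized files, docstrings added) by 19480-p1 g9 on cf-p1's instruction §86(94)/(100).
THE OBJECT (PREREG-G-TWOCENTRE, 19480-p1 g8; vocabulary `…GenericWallFloorShellRowDefs`, p653220): the TWO-CENTRE SHELL ROW of
lane G — a ball `z` of a unit packing CARRYING a shell class (its contacts and its non-contact neighbours within `√(8/3)` at the
listed relative cubic positions) has at most `bound` contacts (`ShellRowHolds`).  Certificate: the unit sphere about `z` is covered by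
the open unit balls about the listed points (so any further touching ball would overlap one of them), checked on a cube-map grid of
`6N²` cells by an exact integer inequality per cell (`shellCellCovered`; radial-projection Lipschitz bound `natSqrtCeil`).

This file: `exists_norm_sub_pointVec_lt_one` (a passing `shellCoverCheck N` ⇒ EVERY unit vector is within `< 1` of some listed point) and
**`shellRowHolds_of_coverCheck (C N) (hint : C.q3Integral = true) (hcheck : shellCoverCheck N C.q3 = true) : ShellRowHolds C`** —
in a unit packing every contact of a carrier of `C` is then one of the listed points at distance `1`, so `#contacts ≤ C.bound`.
WHAT THIS IS NOT: not the stub; no statement about which packings carry the classes (that is the coverage glue); F-C1 not moved.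
-/

noncomputable section

namespace Summit.Ventures.Crystal3D.Theorems

open Finset
open scoped InnerProductSpace RealInnerProductSpace

/-- **Covering.** If the check passes, every unit vector lies in the open unit ball of some listed point. -/
theorem exists_norm_sub_pointVec_lt_one {N : ℕ} {q3s : List (Fin 3 → ℤ)} (h : shellCoverCheck N q3s = true)
    (u : (EuclideanSpace ℝ (Fin 3))) (hu : ‖u‖ = 1) : ∃ q3 ∈ q3s, ‖u - pointVec q3‖ < 1 := by
  have hN := pos_of_check h
  have hNR : (0 : ℝ) < N := by exact_mod_cast hN
  set v := cubicCoords u with hv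
  have hvv : v ⬝ᵥ v = 1 := by rw [hv, ← norm_sq_eq_cubicCoords, hu, one_pow]
  have hv3 : v 0 ^ 2 + v 1 ^ 2 + v 2 ^ 2 = 1 := by
    simpa [dotProduct, Fin.sum_univ_three, sq] using hvv
  -- the largest coordinate
  obtain ⟨a, -, ha⟩ := Finset.exists_max_image Finset.univ (fun i => |v i|) ⟨0, Finset.mem_univ _⟩
  set m := |v a| with hm
  have hle : ∀ i, |v i| ≤ m := fun i => ha i (Finset.mem_univ _)
  have hsum : ∑ k, v k ^ 2 = 1 := by
    rw [← hvv]; simp only [dotProduct]; exact Finset.sum_congr rfl fun k _ => by ring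
  have hva1 : v a ^ 2 ≤ 1 := by
    rw [← hsum]; exact Finset.single_le_sum (fun k _ => sq_nonneg (v k)) (Finset.mem_univ a)
  have hm1 : m ≤ 1 := by rw [hm]; exact sq_le_one_iff_abs_le_one _ |>.1 hva1
  have hm0 : 0 < m := by
    by_contra hcon
    have hm0' : m ≤ 0 := not_lt.1 hcon
    have h0 : ∀ i, v i = 0 := fun i => abs_nonpos_iff.1 ((hle i).trans hm0')
    have := hv3; rw [h0 0, h0 1, h0 2] at this; norm_num at this
  -- the cell
  set pos : Prop := 0 < v a with hpos
  set face : ℕ := 2 * (a : ℕ) + (if pos then 0 else 1) with hface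
  set i : ℕ := cellIdx N (v (freeAxis1 a) / m) with hi
  set j : ℕ := cellIdx N (v (freeAxis2 a) / m) with hj
  set c : Fin 3 → ℤ := shellCellCentre N face i j with hc
  obtain ⟨hca, hc1, hc2⟩ := shellCellCentre_apply N a pos i j
  rw [← hface, ← hc] at hca hc1 hc2
  obtain ⟨q3, hq, hD, hI⟩ :=
    exists_cellCovered_of_check h (face_lt_six a pos) (cellIdx_lt hN _) (cellIdx_lt hN _)
  rw [← hc] at hD hI
  refine ⟨q3, hq, norm_sub_pointVec_lt_one hN hD hI hu ?_⟩
  -- distance from `u` to the normalised cell centre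
  have hcN : (N : ℝ) ≤ ‖cellVec c‖ := by
    have h2 : ‖cellVec c‖ ^ 2 = (sdot3 c c : ℝ) := norm_sq_cellVec c
    have hsq : (N : ℝ) ^ 2 ≤ ‖cellVec c‖ ^ 2 := by
      rw [h2, show (sdot3 c c : ℝ) = ∑ k, ((c k : ℝ)) ^ 2 by
        simp only [sdot3, Fin.sum_univ_three]; push_cast; ring]
      rw [sum_three_axes a, hca]
      split_ifs <;> push_cast <;> nlinarith [sq_nonneg ((c (freeAxis1 a) : ℝ)), sq_nonneg ((c (freeAxis2 a) : ℝ))]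
    exact (pow_le_pow_iff_left₀ hNR.le (norm_nonneg _) two_ne_zero).1 hsq
  have hc0 : 0 < ‖cellVec c‖ := hNR.trans_le hcN
  set e : (EuclideanSpace ℝ (Fin 3)) := ‖cellVec c‖⁻¹ • cellVec c with he
  have he1 : ‖e‖ = 1 := by rw [he, norm_smul, norm_inv, norm_norm]; field_simp
  -- ‖u − e‖ ≤ ‖m⁻¹ • u − (‖c‖/N) • e‖ = ‖m⁻¹ • u − N⁻¹ • cellVec c‖
  have hstep := norm_sub_le_norm_smul_sub_smul hu he1 (one_le_inv₀ hm0 |>.2 hm1)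
    ((one_le_div hNR).2 hcN)
  have hsc : (‖cellVec c‖ / N) • e = (N : ℝ)⁻¹ • cellVec c := by
    rw [he, smul_smul]; congr 1; field_simp
  rw [hsc] at hstep
  refine hstep.trans ?_
  -- coordinates of the difference
  have hd : cubicCoords (m⁻¹ • u - (N : ℝ)⁻¹ • cellVec c) = fun k => v k / m - (c k : ℝ) / N := by
    rw [cubicCoords_sub, cubicCoords_smul, cubicCoords_smul, cubicCoords_cellVec, ← hv]
    ext k; simp [div_eq_inv_mul]
  -- axis a: zero
  have h0 : v a / m - (c a : ℝ) / N = 0 := by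
    rw [hca]
    by_cases hp : pos
    · rw [if_pos hp]; push_cast
      have : m = v a := by rw [hm]; exact abs_of_pos hp
      rw [this, div_self (by rw [← this]; exact hm0.ne'), div_self hNR.ne']; ring
    · rw [if_neg hp]; push_cast
      have hneg : v a < 0 := by
        rcases lt_trichotomy (v a) 0 with hlt | heq | hgt
        · exact hlt
        · exfalso; rw [hm, heq, abs_zero] at hm0; exact lt_irrefl _ hm0
        · exact absurd hgt hp
      have : m = -v a := by rw [hm]; exact abs_of_neg hneg
      rw [this, neg_div, div_neg, div_self hneg.ne, div_self hNR.ne']; ring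
  -- free axes: within 1/N
  have hw1 : |v (freeAxis1 a) / m| ≤ 1 := by
    rw [abs_div, abs_of_pos hm0, div_le_one hm0]; exact hle _
  have hw2 : |v (freeAxis2 a) / m| ≤ 1 := by
    rw [abs_div, abs_of_pos hm0, div_le_one hm0]; exact hle _
  have h1 := abs_sub_cellCentre_le hN hw1
  have h2 := abs_sub_cellCentre_le hN hw2
  rw [← hi] at h1; rw [← hj] at h2
  have f1 : (v (freeAxis1 a) / m - (c (freeAxis1 a) : ℝ) / N) ^ 2 ≤ (1 / N) ^ 2 := by
    rw [hc1, ← sq_abs]; exact pow_le_pow_left₀ (abs_nonneg _) h1 2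
  have f2 : (v (freeAxis2 a) / m - (c (freeAxis2 a) : ℝ) / N) ^ 2 ≤ (1 / N) ^ 2 := by
    rw [hc2, ← sq_abs]; exact pow_le_pow_left₀ (abs_nonneg _) h2 2
  have fa : (v a / m - (c a : ℝ) / N) ^ 2 = 0 := by rw [h0]; ring
  have hdot : (fun k => v k / m - (c k : ℝ) / N) ⬝ᵥ (fun k => v k / m - (c k : ℝ) / N)
      = (v a / m - (c a : ℝ) / N) ^ 2 + (v (freeAxis1 a) / m - (c (freeAxis1 a) : ℝ) / N) ^ 2
        + (v (freeAxis2 a) / m - (c (freeAxis2 a) : ℝ) / N) ^ 2 := by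
    simp only [dotProduct]; rw [sum_three_axes a]; ring
  have hs22 : (Real.sqrt 2 / N) ^ 2 = (1 / N) ^ 2 + (1 / N) ^ 2 := by
    rw [div_pow, Real.sq_sqrt (by norm_num : (0:ℝ) ≤ 2)]; ring
  have hn2 : ‖m⁻¹ • u - (N : ℝ)⁻¹ • cellVec c‖ ^ 2 ≤ (Real.sqrt 2 / N) ^ 2 := by
    rw [norm_sq_eq_cubicCoords, hd, hdot, hs22, fa]; linarith [f1, f2]
  exact (pow_le_pow_iff_left₀ (norm_nonneg _) (by positivity) two_ne_zero).1 hn2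

/-- For `q ∈ (1/3)ℤ³`, the listed point of `3 • q` is `cubicVecQ q`. -/
theorem pointVec_num_eq_cubicVecQ (q : Fin 3 → ℚ) (hq : ∀ i, (3 * q i).den = 1) :
    pointVec (fun i => (3 * q i).num) = cubicVecQ q := by
  rw [pointVec, cubicVecQ_eq_ofCubic]; congr 1; ext i
  have h : (((3 * q i).num : ℤ) : ℚ) = 3 * q i := by
    have := Rat.num_div_den (3 * q i)
    rw [hq i] at this; simpa using this
  have h' : (((3 * q i).num : ℤ) : ℝ) = 3 * ((q i : ℚ) : ℝ) := by
    have e : ((((3 * q i).num : ℤ) : ℚ) : ℝ) = ((3 * q i : ℚ) : ℝ) := by rw [h]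
    push_cast at e; exact e
  rw [h']; field_simp

/-- Norm² of `cubicVecQ q` in terms of the rational data. -/
theorem norm_sq_cubicVecQ (q : Fin 3 → ℚ) :
    ‖cubicVecQ q‖ ^ 2 = ((q 0 * q 0 + q 1 * q 1 + q 2 * q 2 : ℚ) : ℝ) / 2 := by
  have hs : Real.sqrt 2 ^ 2 = 2 := Real.sq_sqrt (by norm_num)
  have hs0 : Real.sqrt 2 ≠ 0 := by positivity
  rw [cubicVecQ_eq_ofCubic, norm_sq_ofCubic]; simp only [dotProduct, Fin.sum_univ_three]; push_cast
  field_simp; rw [hs]; ring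

/-- **THE BRIDGE.** A class with third-integral data whose cube-map certificate passes satisfies its shell row:
in every unit packing, a ball carrying the class has at most `C.bound` contacts.  (Every contact of the carrier is
within distance `< 1` of a listed ball, hence IS a listed ball, hence one of the listed contacts.) -/
theorem shellRowHolds_of_coverCheck (C : ShellClass) (N : ℕ) (hint : C.q3Integral = true)
    (hcheck : shellCoverCheck N C.q3 = true) : ShellRowHolds C := by
  classical
  intro Y hY z hz hblk
  obtain ⟨G, hG⟩ := hblk
  simp only [ShellClass.q3Integral, Bool.and_eq_true, List.all_eq_true, decide_eq_true_eq, beq_iff_eq] at hint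
  obtain ⟨hden, hbound⟩ := hint
  set L := C.present.filter (fun q => q 0 * q 0 + q 1 * q 1 + q 2 * q 2 = 2) with hL
  have key : ∀ y ∈ Y.filter (fun q => dist z q = 1), ∃ q ∈ L, y = z + G (cubicVecQ q) := by
    intro y hy
    rw [Finset.mem_filter] at hy
    obtain ⟨hyY, hd⟩ := hy
    set u := G.symm (y - z) with hu
    have hu1 : ‖u‖ = 1 := by rw [hu, LinearIsometryEquiv.norm_map, ← dist_eq_norm, dist_comm, hd]
    obtain ⟨q3, hq3, hlt⟩ := exists_norm_sub_pointVec_lt_one hcheck u hu1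
    rw [ShellClass.q3, List.mem_map] at hq3
    obtain ⟨q, hq, rfl⟩ := hq3
    have hpt : pointVec (fun i => (3 * q i).num) = cubicVecQ q :=
      pointVec_num_eq_cubicVecQ q fun i => hden q hq i (List.mem_finRange i)
    rw [hpt] at hlt
    have hw : z + G (cubicVecQ q) ∈ Y := hG q hq
    have hdist : dist y (z + G (cubicVecQ q)) < 1 := by
      rw [dist_eq_norm]
      have : y - (z + G (cubicVecQ q)) = G u - G (cubicVecQ q) := by
        rw [hu, LinearIsometryEquiv.apply_symm_apply]; abel
      rw [this, ← map_sub, LinearIsometryEquiv.norm_map]; exact hlt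
    have heq : y = z + G (cubicVecQ q) := by
      by_contra hne
      have := hY y hyY _ hw hne
      linarith
    refine ⟨q, ?_, heq⟩
    rw [hL, List.mem_filter]
    refine ⟨hq, ?_⟩
    have hn : ‖cubicVecQ q‖ = 1 := by
      have : G (cubicVecQ q) = y - z := by rw [heq]; abel
      rw [← G.norm_map, this, ← dist_eq_norm, dist_comm, hd]
    have hn2 := norm_sq_cubicVecQ q
    rw [hn, one_pow] at hn2
    have : ((q 0 * q 0 + q 1 * q 1 + q 2 * q 2 : ℚ) : ℝ) = 2 := by linarith
    have hQ : q 0 * q 0 + q 1 * q 1 + q 2 * q 2 = 2 := by exact_mod_cast this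
    exact decide_eq_true hQ
  calc (Y.filter fun q => dist z q = 1).card
      ≤ (L.toFinset.image fun q => z + G (cubicVecQ q)).card := by
        apply Finset.card_le_card
        intro y hy
        obtain ⟨q, hq, rfl⟩ := key y hy
        exact Finset.mem_image.2 ⟨q, List.mem_toFinset.2 hq, rfl⟩
    _ ≤ L.toFinset.card := Finset.card_image_le
    _ ≤ L.length := List.toFinset_card_le _
    _ ≤ C.bound := hbound

end Summit.Ventures.Crystal3D.Theorems

end
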